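/-
Copyright (c) 2026 the pub-hodgecm-mathlib formalisation cell (harness21).  Prover seat hodgecm-mathlib-LH4-p13 (g8), req620 Track A «(D-RAM) FOUR-FRAME» squad, tier 0,
STAGE-1b PRE-SCOPING (heir LEAD F0P3a-plan (g20) T19-24∕T19-31 (R-29)(b); dealer LH4-plan (g12) WORD #45∕#50 «(α) ↦ p13»): organ (L-lab) «THE LABEL LAW» — brick (L-lab-10)
«VALUE SETS ARE LEVEL-CLASS FUNCTIONS AT A VERTEX, AND THE THREE DIAGONAL READINGS OF A FRAME ELEMENT»: adding an operator of level `m` on `M` (e.g. a scalar `λ·1`, `|λ| ≤ |ϖ|^m`)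
does not change the `ϖ^m`-thickened value set at a vertex; so `diag(α−1, β−1, 0)`, `diag(α−β, 0, 1−β)` and `diag(0, β−α, 1−α)` carry the SAME label near 1 — the glued
two-slot vertices are one-slot vertices in a rotated reading, and the third root `α − β` enters the label.  2026-09-04.
-/
import Summits.HodgeConjecture.HodgeConjecture.Theorems.F0P3cDyRamLabelCountDiagonalModel        -- ★ p859223 (this seat, (L-lab-7)): `pairing_diagonal_mulVec_diagonal(_three)`, the model label currency; brings ★ U2G DEFS, ★ p858764
import Literature.NumberTheory.Automorphic.UnitaryLatticeTreeCentralRescalingCountTransport      -- ★ `v_pairing_mulVec_le_of_map_le_scaleLattice` (values at a vertex), brings ★ `mem_scaleLattice_iff`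
import HarnessLib

/-!
# Crux `H413`, line LH4 «(D-RAM) FOUR-FRAME», tier 0, STAGE-1b pre-scoping — (L-lab-10): the `ϖ^m`-thickened value set at a vertex is a LEVEL-CLASS function of the operator;
# the three diagonal readings `diag(α−1, β−1, 0) ∼ diag(α−β, 0, 1−β) ∼ diag(0, β−α, 1−α)` of a frame element near 1

Cell `hodgecm-mathlib` (D-0151), FLOOR 0, crux item H413 = `stmt-HodgeConjecture-24833`, route of record `HCCMUnconditional`; squad F0∕P3c∕LH4.  SCOPING INVENTORY for the
STAGE-1b directive ((α₁): the label trichotomy on the type-(1) population — fixed type-0 vertices of near-1 four-frame elements — in ★ p859223's diagonal model; LH4-p09 (g8)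
(L-model-G) glued strata).  THEOREMS ONLY (no `def`, no instance, no notation, no `sorry`, default heartbeats), ★-only imports, lane `--supports stmt-HodgeConjecture-24833 --as helper`;
pays NO row, states NO law.

THE MATHEMATICS.  At a vertex `M` of the tree of `(K^N, H)` (any type; `M ≤ M^♯`, ★ `v_pairing_mulVec_le_of_map_le_scaleLattice`): if `D·M ⊆ ϖ^m·M` then `⟨y, Dy⟩_H ∈ ϖ^m𝒪` for
`y ∈ M`, so the `ϖ^m`-thickened value sets of `X + D` and `X` on `M` COINCIDE (§1; the vertex twin of ★ `valueSetMod_add_eq`, which is the case `M = 𝒪³`).  A scalar `λ·1` with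
`|λ| ≤ |ϖ^m|` is such a `D` on every lattice (§2).  Hence for a type-(1) frame element at depth `min(v(α−1), v(β−1)) ≥ m` (always the case near 1: `N₀ ≥ m*`), in ★ p859223's model
`(diag(c), T = diag(α, β, 1))` the label token may be read off ANY of
  `diag(α−1, β−1, 0) = T − 1`,   `diag(α−β, 0, 1−β) = T − β·1`,   `diag(0, β−α, 1−α) = T − α·1`   (§3),
whose values at `y` are the binary norm forms `c₀(α−1)N(y₀) + c₁(β−1)N(y₁)`, `c₀(α−β)N(y₀) − c₂(β−1)N(y₂)`, `−c₁(α−β)N(y₁) − c₂(α−1)N(y₂)` (★ `pairing_diagonal_mulVec_diagonal_three`).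
WHY IT MATTERS (F0P3a-p01 STRATA memo (S2) «the κ-content lives on the spine», F0P3-p01 TEMPLATE §2 «B₃ ↔ v(α−β)»): a self-dual vertex reaching depth `−a` in slots 0 AND 1 forces
`c₀N(y₀) + c₁N(y₁) ≡ −c₂N(y₂) + 𝒪` (isotropy of the glued pair), so in the first reading BOTH slots are visible and seem to compete — but in the second reading the same vertex is
ONE-SLOT with scalar `c₀(α−β)` (slot 2's coefficient `β − 1` is deep): the glued `(0,1)`-strata are labelled through the THIRD root `α − β`, by the one-slot chain ★ (L-lab-1)∕(L-lab-3)∕(L-lab-5)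
verbatim.  This is the mechanism behind «glued shell strata ARE labelled» ((7,7,9) strata (3,3,0), (3,3,2) …) and behind the third-slot dependence of the fitted T₊ law.

* §1 **`setOf_value_add_eq_of_map_le_scaleLattice`** (any `H`, any vertex type; set-builder currency of ★ p859223), **`latticeValueSetMod_add_eq_of_latticeInLevel`** ∕
  `latticeLabelPlus_add_iff_of_latticeInLevel` (★ U2G `Φ₃` currency).
* §2 `map_toLin'_smul_one_le_scaleLattice` (a small scalar is a level-`m` operator on every lattice), **`latticeValueSetMod_add_smul_one_eq`**, `latticeLabelPlus_add_smul_one_iff`,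
  `setOf_value_add_smul_one_eq` (any `H`).
* §3 `diagonal_three_add_smul_one_snd` ∕ `…_fst` (the matrix identities), **`setOf_value_diagonal_eq_of_snd_deep`** ∕ **`…_of_fst_deep`**: at a vertex of `diag(c)` with `|β − 1| ≤ |ϖ^m|`
  (resp. `|α − 1| ≤ |ϖ^m|`) the model label set of `diag(α−1, β−1, 0)` equals that of `diag(α−β, 0, 1−β)` (resp. `diag(0, β−α, 1−α)`), written as the explicit norm forms.
HONEST LABEL.  Count-neutral scoping brick; the three tier-0 rows stay OPEN; `HC_CM` is proved only modulo the 7 printed citations (2 remaining named inputs: hLiu418 =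
`stmt-HodgeConjecture-24832`, h413 = `stmt-HodgeConjecture-24833`) until rung 0 closes.

## References
* [Kottwitz1986BaseChangeUnits] R. E. Kottwitz, *Base change for unit elements of Hecke algebras*, Compositio Math. 60 (1986), §1 pp. 240–241 (congruence classes of `γ` on a fixed lattice).
* [Jacobowitz1962] R. Jacobowitz, *Hermitian forms over local fields*, Amer. J. Math. 84 (1962), §4 (hermitian lattices, duals, values).
* [Rogawski1990] J. D. Rogawski, *Automorphic Representations of Unitary Groups in Three Variables*, Ann. of Math. Stud. 123 (1990), §4.9 Prop. 4.9.1 (b) p. 55, §3.6 pp. 28–29.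
* [LanglandsShelstad1987] R. P. Langlands, D. Shelstad, *On the definition of transfer factors*, Math. Ann. 278 (1987), §3.
-/

set_option autoImplicit false

noncomputable section

namespace Summit.HodgeConjecture.HodgeConjecture.Cruxes.H413.F0P3cDyRamValueSetLevelShift

open Literature.NumberTheory.Automorphic Literature.NumberTheory.Automorphic.HermitianLattice
open Literature.NumberTheory.Automorphic.UnitaryLatticeTree Literature.NumberTheory.Automorphic.UnitaryThreeFourFrame
open Summit.HodgeConjecture.HodgeConjecture.Cruxes.H413.F0P3cDyRamFourFramePieces
open Summit.HodgeConjecture.HodgeConjecture.Cruxes.H413.F0P3cDyRamFourFrameCensusDefs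
open Summit.HodgeConjecture.HodgeConjecture.Cruxes.H413.F0P3cDyRamLabelCountDiagonalModel (pairing_diagonal_mulVec_diagonal_three)
open scoped Matrix MatrixGroups Valued WithZero

variable {K : Type*} [Field K] [Valued K ℤᵐ⁰] {N : ℕ}

/-! ## §1  The thickened value set at a vertex is a level-class function of the operator -/

/-- **`D·M ⊆ ϖ^m·M ⇒` the `ϖ^m`-thickened value sets of `X + D` and `X` on the vertex `M` coincide** (any hermitian matrix `H`, any vertex type; `σ` isometric): for `y ∈ M`,
`⟨y, (X + D)y⟩ − ⟨y, Xy⟩ = ⟨y, Dy⟩ ∈ ϖ^m·𝒪` (★ `v_pairing_mulVec_le_of_map_le_scaleLattice`).  Set-builder currency of ★ p859223. [cite: Kottwitz1986BaseChangeUnits, §1 pp. 240–241] [cite: Jacobowitz1962, §4] -/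
theorem setOf_value_add_eq_of_map_le_scaleLattice {σ : K →+* K} (hvσ : ∀ a, Valued.v (σ a) = Valued.v a) {ϖ : K} (hϖ0 : ϖ ≠ 0) {H : Matrix (Fin N) (Fin N) K} {t : ℕ}
    {M : Submodule 𝒪[K] (Fin N → K)} (hM : IsVertexLattice σ ϖ H t M) (m : ℕ) (X : Matrix (Fin N) (Fin N) K) {D : Matrix (Fin N) (Fin N) K}
    (hD : M.map ((Matrix.toLin' D).restrictScalars 𝒪[K]) ≤ scaleLattice (ϖ ^ m) M) :
    {v | ∃ y ∈ M, Valued.v ((ϖ ^ m)⁻¹ * (v - pairing σ H y ((X + D) *ᵥ y))) ≤ 1} =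
      {v | ∃ y ∈ M, Valued.v ((ϖ ^ m)⁻¹ * (v - pairing σ H y (X *ᵥ y))) ≤ 1} := by
  have hc : (ϖ ^ m : K) ≠ 0 := pow_ne_zero m hϖ0
  have hval : ∀ y ∈ M, Valued.v ((ϖ ^ m)⁻¹ * pairing σ H y (D *ᵥ y)) ≤ 1 := by
    intro y hy
    have h := v_pairing_mulVec_le_of_map_le_scaleLattice hvσ hM hc hD hy
    rw [map_mul, map_inv₀]
    exact (inv_mul_le_one₀ ((Valuation.pos_iff _).2 hc)).2 h
  have key : ∀ (v : K), ∀ y ∈ M,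
      (Valued.v ((ϖ ^ m)⁻¹ * (v - pairing σ H y ((X + D) *ᵥ y))) ≤ 1 ↔ Valued.v ((ϖ ^ m)⁻¹ * (v - pairing σ H y (X *ᵥ y))) ≤ 1) := by
    intro v y hy
    have e : (ϖ ^ m)⁻¹ * (v - pairing σ H y ((X + D) *ᵥ y)) = (ϖ ^ m)⁻¹ * (v - pairing σ H y (X *ᵥ y)) - (ϖ ^ m)⁻¹ * pairing σ H y (D *ᵥ y) := by
      rw [Matrix.add_mulVec, map_add]; ring
    constructor
    · intro h
      have e' : (ϖ ^ m)⁻¹ * (v - pairing σ H y (X *ᵥ y)) = (ϖ ^ m)⁻¹ * (v - pairing σ H y ((X + D) *ᵥ y)) + (ϖ ^ m)⁻¹ * pairing σ H y (D *ᵥ y) := by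
        rw [e, sub_add_cancel]
      rw [e']
      exact Valuation.map_add_le _ h (hval y hy)
    · intro h
      rw [e]
      exact Valuation.map_sub_le _ h (hval y hy)
  ext v
  simp only [Set.mem_setOf_eq]
  constructor
  · rintro ⟨y, hy, h⟩
    exact ⟨y, hy, (key v y hy).1 h⟩
  · rintro ⟨y, hy, h⟩
    exact ⟨y, hy, (key v y hy).2 h⟩

/-- **THE VALUE SET AT A VERTEX IS A LEVEL-CLASS FUNCTION** (★ U2G currency): `LatticeInLevel ϖ m D M ⇒ latticeValueSetMod σ ϖ m M (X + D) = latticeValueSetMod σ ϖ m M X` for a vertex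
`M` of `(K³, Φ₃)` of any type (the vertex twin of ★ `valueSetMod_add_eq`). [cite: Kottwitz1986BaseChangeUnits, §1 pp. 240–241] [cite: Rogawski1990, §4.9 Prop. 4.9.1 (b) p. 55] -/
theorem latticeValueSetMod_add_eq_of_latticeInLevel {σ : K →+* K} (hvσ : ∀ a, Valued.v (σ a) = Valued.v a) {ϖ : K} (hϖ0 : ϖ ≠ 0) {t : ℕ}
    {M : Submodule 𝒪[K] (Fin 3 → K)} (hM : IsVertexLattice σ ϖ ((StdForm.antidiagonal 3).over K) t M) (m : ℕ) (X : Matrix (Fin 3) (Fin 3) K)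
    {D : Matrix (Fin 3) (Fin 3) K} (hD : LatticeInLevel ϖ m D M) :
    latticeValueSetMod σ ϖ m M (X + D) = latticeValueSetMod σ ϖ m M X := by
  unfold latticeValueSetMod
  exact setOf_value_add_eq_of_map_le_scaleLattice hvσ hϖ0 hM m X hD

/-- Hence **the label at a vertex is a level-class function**: `LatticeLabelPlus σ ϖ d m M (X + D) ↔ LatticeLabelPlus σ ϖ d m M X` for `D·M ⊆ ϖ^m·M`.
[cite: Kottwitz1986BaseChangeUnits, §1 pp. 240–241] [cite: Rogawski1990, §4.9 Prop. 4.9.1 (b) p. 55] -/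
theorem latticeLabelPlus_add_iff_of_latticeInLevel {σ : K →+* K} (hvσ : ∀ a, Valued.v (σ a) = Valued.v a) {ϖ : K} (hϖ0 : ϖ ≠ 0) {t : ℕ}
    {M : Submodule 𝒪[K] (Fin 3 → K)} (hM : IsVertexLattice σ ϖ ((StdForm.antidiagonal 3).over K) t M) (d m : ℕ) (X : Matrix (Fin 3) (Fin 3) K)
    {D : Matrix (Fin 3) (Fin 3) K} (hD : LatticeInLevel ϖ m D M) :
    LatticeLabelPlus σ ϖ d m M (X + D) ↔ LatticeLabelPlus σ ϖ d m M X := by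
  rw [LatticeLabelPlus, LatticeLabelPlus, latticeValueSetMod_add_eq_of_latticeInLevel hvσ hϖ0 hM m X hD]

/-! ## §2  Small scalars are level-`m` operators on every lattice -/

/-- A scalar `λ·1` with `|λ| ≤ |ϖ^m|` (`ϖ ≠ 0`) has level `m` on EVERY lattice: `(λ·1)·M ⊆ ϖ^m·M` (`(ϖ^m)⁻¹λ ∈ 𝒪`). [cite: Kottwitz1986BaseChangeUnits, §1 pp. 240–241] -/
theorem map_toLin'_smul_one_le_scaleLattice {ϖ : K} (hϖ0 : ϖ ≠ 0) {m : ℕ} {lam : K} (hlam : Valued.v lam ≤ Valued.v (ϖ ^ m)) (M : Submodule 𝒪[K] (Fin N → K)) :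
    M.map ((Matrix.toLin' (lam • (1 : Matrix (Fin N) (Fin N) K))).restrictScalars 𝒪[K]) ≤ scaleLattice (ϖ ^ m) M := by
  have hc : (ϖ ^ m : K) ≠ 0 := pow_ne_zero m hϖ0
  have hint : Valued.v ((ϖ ^ m)⁻¹ * lam) ≤ 1 := by
    rw [map_mul, map_inv₀]
    exact (inv_mul_le_one₀ ((Valuation.pos_iff _).2 hc)).2 hlam
  rw [Submodule.map_le_iff_le_comap]
  intro y hy
  rw [Submodule.mem_comap, LinearMap.restrictScalars_apply, Matrix.toLin'_apply, Matrix.smul_mulVec, Matrix.one_mulVec, mem_scaleLattice_iff hc, smul_smul]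
  exact M.smul_mem (⟨(ϖ ^ m)⁻¹ * lam, hint⟩ : 𝒪[K]) hy

/-- Any form, any vertex: the value sets of `X + λ·1` and `X` coincide when `|λ| ≤ |ϖ^m|`. [cite: Kottwitz1986BaseChangeUnits, §1 pp. 240–241] [cite: Jacobowitz1962, §4] -/
theorem setOf_value_add_smul_one_eq {σ : K →+* K} (hvσ : ∀ a, Valued.v (σ a) = Valued.v a) {ϖ : K} (hϖ0 : ϖ ≠ 0) {H : Matrix (Fin N) (Fin N) K} {t : ℕ}
    {M : Submodule 𝒪[K] (Fin N → K)} (hM : IsVertexLattice σ ϖ H t M) {m : ℕ} (X : Matrix (Fin N) (Fin N) K) {lam : K} (hlam : Valued.v lam ≤ Valued.v (ϖ ^ m)) :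
    {v | ∃ y ∈ M, Valued.v ((ϖ ^ m)⁻¹ * (v - pairing σ H y ((X + lam • (1 : Matrix (Fin N) (Fin N) K)) *ᵥ y))) ≤ 1} =
      {v | ∃ y ∈ M, Valued.v ((ϖ ^ m)⁻¹ * (v - pairing σ H y (X *ᵥ y))) ≤ 1} :=
  setOf_value_add_eq_of_map_le_scaleLattice hvσ hϖ0 hM m X (map_toLin'_smul_one_le_scaleLattice hϖ0 hlam M)

/-- **`latticeValueSetMod σ ϖ m M (X + λ·1) = latticeValueSetMod σ ϖ m M X`** for `|λ| ≤ |ϖ^m|` at a vertex `M` of `(K³, Φ₃)` — e.g. `Γ − β·1` versus `Γ − 1` near 1.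
[cite: Kottwitz1986BaseChangeUnits, §1 pp. 240–241] [cite: Rogawski1990, §4.9 Prop. 4.9.1 (b) p. 55] -/
theorem latticeValueSetMod_add_smul_one_eq {σ : K →+* K} (hvσ : ∀ a, Valued.v (σ a) = Valued.v a) {ϖ : K} (hϖ0 : ϖ ≠ 0) {t : ℕ}
    {M : Submodule 𝒪[K] (Fin 3 → K)} (hM : IsVertexLattice σ ϖ ((StdForm.antidiagonal 3).over K) t M) {m : ℕ} (X : Matrix (Fin 3) (Fin 3) K)
    {lam : K} (hlam : Valued.v lam ≤ Valued.v (ϖ ^ m)) :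
    latticeValueSetMod σ ϖ m M (X + lam • (1 : Matrix (Fin 3) (Fin 3) K)) = latticeValueSetMod σ ϖ m M X :=
  latticeValueSetMod_add_eq_of_latticeInLevel hvσ hϖ0 hM m X (map_toLin'_smul_one_le_scaleLattice hϖ0 hlam M)

/-- `LatticeLabelPlus σ ϖ d m M (X + λ·1) ↔ LatticeLabelPlus σ ϖ d m M X` for `|λ| ≤ |ϖ^m|` at a vertex. [cite: Kottwitz1986BaseChangeUnits, §1 pp. 240–241] -/
theorem latticeLabelPlus_add_smul_one_iff {σ : K →+* K} (hvσ : ∀ a, Valued.v (σ a) = Valued.v a) {ϖ : K} (hϖ0 : ϖ ≠ 0) {t : ℕ}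
    {M : Submodule 𝒪[K] (Fin 3 → K)} (hM : IsVertexLattice σ ϖ ((StdForm.antidiagonal 3).over K) t M) (d : ℕ) {m : ℕ} (X : Matrix (Fin 3) (Fin 3) K)
    {lam : K} (hlam : Valued.v lam ≤ Valued.v (ϖ ^ m)) :
    LatticeLabelPlus σ ϖ d m M (X + lam • (1 : Matrix (Fin 3) (Fin 3) K)) ↔ LatticeLabelPlus σ ϖ d m M X := by
  rw [LatticeLabelPlus, LatticeLabelPlus, latticeValueSetMod_add_smul_one_eq hvσ hϖ0 hM X hlam]

/-! ## §3  The three diagonal readings of a frame element in the model `(diag(c), diag(α, β, 1))` -/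

omit [Valued K ℤᵐ⁰] in
/-- `diag(α−1, β−1, 0) + (1−β)·1 = diag(α−β, 0, 1−β)`. [cite: Rogawski1990, §3.6 pp. 28–29] -/
theorem diagonal_three_add_smul_one_snd (α β : K) :
    Matrix.diagonal ![α - 1, β - 1, 0] + (1 - β) • (1 : Matrix (Fin 3) (Fin 3) K) = Matrix.diagonal ![α - β, 0, 1 - β] := by
  rw [Matrix.smul_one_eq_diagonal, Matrix.diagonal_add]
  congr 1
  funext i
  fin_cases i <;> simp

omit [Valued K ℤᵐ⁰] in
/-- `diag(α−1, β−1, 0) + (1−α)·1 = diag(0, β−α, 1−α)`. [cite: Rogawski1990, §3.6 pp. 28–29] -/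
theorem diagonal_three_add_smul_one_fst (α β : K) :
    Matrix.diagonal ![α - 1, β - 1, 0] + (1 - α) • (1 : Matrix (Fin 3) (Fin 3) K) = Matrix.diagonal ![0, β - α, 1 - α] := by
  rw [Matrix.smul_one_eq_diagonal, Matrix.diagonal_add]
  congr 1
  funext i
  fin_cases i <;> simp

/-- **THE SECOND READING**: at a vertex `M` of `(K³, diag(c))` with `|β − 1| ≤ |ϖ^m|`, the model label set of `diag(α−1, β−1, 0)` — the norm form `c₀(α−1)N(y₀) + c₁(β−1)N(y₁)` of ★
p859223 — equals that of `diag(α−β, 0, 1−β)`, the norm form `c₀(α−β)N(y₀) + c₂(1−β)N(y₂)`: on the `(0,1)`-glued strata the label is read on slot 0 ALONE with scalar `c₀(α − β)`.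
[cite: Kottwitz1986BaseChangeUnits, §1 pp. 240–241] [cite: Rogawski1990, §4.9 Prop. 4.9.1 (b) p. 55] [cite: LanglandsShelstad1987, §3] -/
theorem setOf_value_diagonal_eq_of_snd_deep {σ : K →+* K} (hvσ : ∀ a, Valued.v (σ a) = Valued.v a) {ϖ : K} (hϖ0 : ϖ ≠ 0) {c : Fin 3 → K} {t : ℕ}
    {M : Submodule 𝒪[K] (Fin 3 → K)} (hM : IsVertexLattice σ ϖ (Matrix.diagonal c) t M) {m : ℕ} {α β : K} (hβ : Valued.v (1 - β) ≤ Valued.v (ϖ ^ m)) :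
    {v | ∃ y ∈ M, Valued.v ((ϖ ^ m)⁻¹ * (v - (c 0 * (α - 1) * (y 0 * σ (y 0)) + c 1 * (β - 1) * (y 1 * σ (y 1))))) ≤ 1} =
      {v | ∃ y ∈ M, Valued.v ((ϖ ^ m)⁻¹ * (v - (c 0 * (α - β) * (y 0 * σ (y 0)) + c 2 * (1 - β) * (y 2 * σ (y 2))))) ≤ 1} := by
  have h := setOf_value_add_smul_one_eq hvσ hϖ0 hM (m := m) (Matrix.diagonal ![α - 1, β - 1, 0]) hβ
  rw [diagonal_three_add_smul_one_snd] at h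
  have e1 : ∀ y : Fin 3 → K, pairing σ (Matrix.diagonal c) y (Matrix.diagonal ![α - β, 0, 1 - β] *ᵥ y) =
      c 0 * (α - β) * (y 0 * σ (y 0)) + c 2 * (1 - β) * (y 2 * σ (y 2)) := by
    intro y
    rw [F0P3cDyRamLabelCountDiagonalModel.pairing_diagonal_mulVec_diagonal, Fin.sum_univ_three]
    simp only [Matrix.cons_val_zero, Matrix.cons_val_one, Matrix.head_cons, Matrix.cons_val_two, Matrix.tail_cons, zero_mul, mul_zero, add_zero]
    ring
  simp only [pairing_diagonal_mulVec_diagonal_three, e1] at h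
  exact h.symm

/-- **THE THIRD READING**: with `|α − 1| ≤ |ϖ^m|`, the model label set of `diag(α−1, β−1, 0)` equals that of `diag(0, β−α, 1−α)`, the norm form `c₁(β−α)N(y₁) + c₂(1−α)N(y₂)`.
[cite: Kottwitz1986BaseChangeUnits, §1 pp. 240–241] [cite: Rogawski1990, §4.9 Prop. 4.9.1 (b) p. 55] [cite: LanglandsShelstad1987, §3] -/
theorem setOf_value_diagonal_eq_of_fst_deep {σ : K →+* K} (hvσ : ∀ a, Valued.v (σ a) = Valued.v a) {ϖ : K} (hϖ0 : ϖ ≠ 0) {c : Fin 3 → K} {t : ℕ}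
    {M : Submodule 𝒪[K] (Fin 3 → K)} (hM : IsVertexLattice σ ϖ (Matrix.diagonal c) t M) {m : ℕ} {α β : K} (hα : Valued.v (1 - α) ≤ Valued.v (ϖ ^ m)) :
    {v | ∃ y ∈ M, Valued.v ((ϖ ^ m)⁻¹ * (v - (c 0 * (α - 1) * (y 0 * σ (y 0)) + c 1 * (β - 1) * (y 1 * σ (y 1))))) ≤ 1} =
      {v | ∃ y ∈ M, Valued.v ((ϖ ^ m)⁻¹ * (v - (c 1 * (β - α) * (y 1 * σ (y 1)) + c 2 * (1 - α) * (y 2 * σ (y 2))))) ≤ 1} := by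
  have h := setOf_value_add_smul_one_eq hvσ hϖ0 hM (m := m) (Matrix.diagonal ![α - 1, β - 1, 0]) hα
  rw [diagonal_three_add_smul_one_fst] at h
  have e1 : ∀ y : Fin 3 → K, pairing σ (Matrix.diagonal c) y (Matrix.diagonal ![0, β - α, 1 - α] *ᵥ y) =
      c 1 * (β - α) * (y 1 * σ (y 1)) + c 2 * (1 - α) * (y 2 * σ (y 2)) := by
    intro y
    rw [F0P3cDyRamLabelCountDiagonalModel.pairing_diagonal_mulVec_diagonal, Fin.sum_univ_three]
    simp only [Matrix.cons_val_zero, Matrix.cons_val_one, Matrix.head_cons, Matrix.cons_val_two, Matrix.tail_cons, zero_mul, mul_zero, zero_add]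
    ring
  simp only [pairing_diagonal_mulVec_diagonal_three, e1] at h
  exact h.symm

end Summit.HodgeConjecture.HodgeConjecture.Cruxes.H413.F0P3cDyRamValueSetLevelShift

end
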